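import Mathlib
import Summits.CriticalPhenomena.CardyFormulaZ2.Theorems.CardyWhiteToColouredDriftBoundPlackettDefs
import Summits.CriticalPhenomena.CardyFormulaZ2.Theorems.CardyWhiteToColouredDriftBoundPlackettDeriv
import Summits.CriticalPhenomena.CardyFormulaZ2.Theorems.CardyWhiteToColouredDriftBoundPlackettIBP
import Summits.CriticalPhenomena.CardyFormulaZ2.Theorems.CardyWhiteToColouredDriftBoundPlackettRegIndicator
import Summits.CriticalPhenomena.CardyFormulaZ2.Theorems.CardyWhiteToColouredDriftBoundPlackettNormWeight

/-!
# Stub `stub_driftIdentity` (S1) — the exact Plackett/Piterbarg drift identity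
# `d/dσ regFlow = plackettDrift`

Helper file for crux item `DriftBound` (stmt-CriticalPhenomena-4596, decl
`Summit.CriticalPhenomena.CardyFormulaZ2.Theses.CardyWhiteToColoured.DriftBound`) of route
`CardyWhiteToColoured` (`CardyFormulaZ2`), line `registered` (`Cruxes/DriftBound/Lines/birth.lean`,
skeleton v4, lead c3), stub S1 = the exact drift identity of the regularised noise heat flow
(Plackett 1954 / Piterbarg's Gaussian interpolation formula; Beliaev–Muirhead–Rivera 2020,
Lemma 2.22, here on the lattice `ℤ²`): for every finite edge set `I`, event `A`, noise level
`η > 0` and width `σ > 0`,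

`HasDerivAt (σ ↦ regFlow I A η σ) (plackettDrift I A η σ) σ`,

i.e. the regularised flow `σ ↦ E[Φ_η(X̃^σ)]` (`Φ_η = regIndicator I A η`, `X̃^σ_i = normNoise σ ξ (m i)`
the variance-normalised smoothed lattice white noise at the medial points `m i`, `i ∈ I`) is
differentiable in the width with derivative the Plackett/Piterbarg pair functional
`∑_{i,j} (∑' e, ∂_σ G_σ(i,e) G_σ(j,e)) E[∂_j ∂_i Φ_η(X̃^σ)]`, `G_σ(i,e) = normWeight σ (m i) e`.

This file is the ASSEMBLY of the identity from the landed generic pieces: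
* `normNoise_eq_tsum`: `X̃^σ_i = ∑' e, G σ i e ξ_e` is an `ℓ¹`-linear Gaussian series, and
  `latticeWhiteNoise = ⨂_e N(0,1)` (`Measure.infinitePi`) by definition;
* `pl_normWeight_family` (file `…PlackettNormWeight`): for each point, differentiability of
  `σ ↦ G σ i e` on `(0, ∞)` and a summable envelope of `G`, `∂_σ G` uniform on `[σ/2, 2σ]`; the
  finitely many envelopes are summed into one (`summable_sum`, `Finset.single_le_sum`);
* `pl_regIndicator_smooth` (file `…PlackettRegIndicator`): `Φ_η ∈ C²_b(ℝ^I)`;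
* `pl_hasDerivAt_integral_linGauss` (file `…PlackettDeriv`): differentiation under the Gaussian
  integral, `d/dσ E[Φ_η(X^σ)] = E[DΦ_η(X^σ)[Ẋ^σ]]`;
* `pl_integral_fderiv_linGauss` (file `…PlackettIBP`): Gaussian integration by parts,
  `E[DΦ_η(X)[V]] = ∑_{i,j} (∑' e, h i e g j e) E[∂_j ∂_i Φ_η(X)]`, which is `plackettDrift` after
  unfolding `plackettCoeff`.

References: R. L. Plackett, *A reduction formula for normal multivariate integrals*, Biometrika 41
(1954); D. Beliaev, S. Muirhead, A. Rivera, *A covariance formula for topological events of smooth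
Gaussian fields*, Ann. Probab. 48 (2020), §2.2, Lemma 2.22 (Piterbarg's formula);
S. Muirhead, H. Vanneuville, Ann. Inst. H. Poincaré Probab. Stat. 56 (2020), §2.1 (discretised
white noise).
-/

noncomputable section

namespace Summit.CriticalPhenomena.CardyFormulaZ2.Cruxes.DriftBound.Birth

open MeasureTheory ProbabilityTheory Set
open Literature.Probability.LatticeModels Literature.Probability.Percolation

/-- The regularised flow written as a Gaussian integral of `Φ_η` at an `ℓ¹`-linear series:
`regFlow I A η s = ∫ Φ_η (i ↦ ∑' e, normWeight s (m i) e ξ_e) d(⨂_e N(0,1))`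
(`normNoise_eq_tsum`; `latticeWhiteNoise` is the infinite product by definition). -/
theorem di_regFlow_eq (I : Finset (Sym2 (Site 2))) (A : Set (Set (Sym2 (Site 2)))) (η s : ℝ) :
    regFlow I A η s = ∫ ξ, regIndicator I A η
      (fun i : I => ∑' e : (zdGraph 2).edgeSet, normWeight s (medialPoint 1 i.1) e * ξ e)
      ∂(Measure.infinitePi (fun _ : (zdGraph 2).edgeSet => gaussianReal 0 1)) := by
  simp only [regFlow, normNoise_eq_tsum]
  rfl

/-- The Plackett/Piterbarg pair functional written with `ℓ¹`-linear series inside the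
expectations and the Plackett coefficients unfolded:
`plackettDrift I A η σ = ∑_i ∑_j (∑' e, ∂_σ G_σ(i,e) G_σ(j,e)) ∫ ∂_j ∂_i Φ_η (i' ↦ ∑' e, G_σ(i',e) ξ_e) d(⨂_e N(0,1))`
— exactly the right-hand side of the generic integration-by-parts identity
`pl_integral_fderiv_linGauss` for `g = G_σ`, `h = ∂_σ G_σ`. -/
theorem di_plackettDrift_eq (I : Finset (Sym2 (Site 2))) (A : Set (Set (Sym2 (Site 2))))
    (η σ : ℝ) :
    plackettDrift I A η σ = ∑ i : I, ∑ j : I,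
      (∑' e : (zdGraph 2).edgeSet, deriv (fun t : ℝ => normWeight t (medialPoint 1 i.1) e) σ *
        normWeight σ (medialPoint 1 j.1) e) *
      ∫ ξ, fderiv ℝ (fun y : I → ℝ => fderiv ℝ (regIndicator I A η) y (Pi.single i 1))
        (fun i' : I => ∑' e : (zdGraph 2).edgeSet, normWeight σ (medialPoint 1 i'.1) e * ξ e)
        (Pi.single j 1) ∂(Measure.infinitePi (fun _ : (zdGraph 2).edgeSet => gaussianReal 0 1)) := by
  simp only [plackettDrift, plackettCoeff, normNoise_eq_tsum]
  rfl

/-- **Stub S1 — the exact drift identity (Plackett 1954 / Piterbarg; Beliaev–Muirhead–Rivera 2020,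
Lemma 2.22, on the lattice).** For every finite edge set `I`, event `A`, noise level `η > 0` and
width `σ > 0`, the regularised flow `σ ↦ regFlow I A η σ = E[Φ_η(X̃^σ)]` is differentiable with
derivative the Plackett/Piterbarg pair functional `plackettDrift I A η σ`.
Proof: write `regFlow` as `∫ Φ_η(∑' e, normWeight σ (m i) e ξ_e)` (`di_regFlow_eq`); on the window
`(σ/2, 2σ) ∋ σ` the kernels `G s i e = normWeight s (m i) e` are differentiable in `s` with
`G`, `∂_s G` dominated by the sum over `i ∈ I` of the envelopes of `pl_normWeight_family`;
`Φ_η ∈ C²_b` by `pl_regIndicator_smooth`; differentiate under the Gaussian integral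
(`pl_hasDerivAt_integral_linGauss`) and integrate the derivative by parts
(`pl_integral_fderiv_linGauss`), landing on `plackettDrift` (`di_plackettDrift_eq`). -/
theorem stub_driftIdentity : ∀ (I : Finset (Sym2 (Literature.Probability.LatticeModels.Site 2))) (A : Set (Set (Sym2 (Literature.Probability.LatticeModels.Site 2)))) (η σ : ℝ), 0 < η → 0 < σ → HasDerivAt (fun s : ℝ => regFlow I A η s) (plackettDrift I A η σ) σ := by
  intro I A η σ hη hσ
  -- the compact window `[a, b] = [σ/2, 2σ] ∋ σ` in `(0, ∞)`
  set a : ℝ := σ / 2 with ha_def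
  set b : ℝ := 2 * σ with hb_def
  have ha : 0 < a := by rw [ha_def]; positivity
  have hab : a ≤ b := by rw [ha_def, hb_def]; linarith
  have hσab : σ ∈ Ioo a b := ⟨by rw [ha_def]; linarith, by rw [hb_def]; linarith⟩
  have hσIcc : σ ∈ Icc a b := Ioo_subset_Icc_self hσab
  -- the normalised kernel family at the medial points `m i`, `i ∈ I`
  have hfam := fun i : I => pl_normWeight_family (medialPoint 1 i.1) a b ha hab
  have hdiff : ∀ (i : I) (e : (zdGraph 2).edgeSet) (s : ℝ), 0 < s →
      HasDerivAt (fun t : ℝ => normWeight t (medialPoint 1 i.1) e)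
        (deriv (fun t : ℝ => normWeight t (medialPoint 1 i.1) e) s) s :=
    fun i e s hs => ((hfam i).2.1 e s hs).hasDerivAt
  have hU : ∀ i : I, ∃ u : (zdGraph 2).edgeSet → ℝ, Summable u ∧ ∀ s ∈ Icc a b,
      ∀ e : (zdGraph 2).edgeSet, |normWeight s (medialPoint 1 i.1) e| ≤ u e ∧
        |deriv (fun t : ℝ => normWeight t (medialPoint 1 i.1) e) s| ≤ u e :=
    fun i => (hfam i).2.2.2
  choose U hUs hUb using hU
  -- one summable envelope for all points: the sum of the finitely many envelopes
  have hU0 : ∀ (i : I) (e : (zdGraph 2).edgeSet), 0 ≤ U i e := fun i e =>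
    (abs_nonneg _).trans (hUb i σ hσIcc e).1
  have hle : ∀ (i : I) (e : (zdGraph 2).edgeSet), U i e ≤ ∑ j : I, U j e := fun i e =>
    Finset.single_le_sum (f := fun j : I => U j e) (fun j _ => hU0 j e) (Finset.mem_univ i)
  have hu : Summable fun e : (zdGraph 2).edgeSet => ∑ j : I, U j e :=
    summable_sum fun j _ => hUs j
  -- the regularised indicator is `C²_b`
  obtain ⟨hΦ2, M, hΦM, hΦ'M, hΦ''M⟩ := pl_regIndicator_smooth I A η hη
  have hΦ1 : ContDiff ℝ 1 (regIndicator I A η) := hΦ2.of_le (by norm_num)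
  -- differentiation under the Gaussian integral
  have hmain := pl_hasDerivAt_integral_linGauss (ι := (zdGraph 2).edgeSet) (I := I) a b σ hσab
    (fun s (i : I) e => normWeight s (medialPoint 1 i.1) e)
    (fun s (i : I) e => deriv (fun t : ℝ => normWeight t (medialPoint 1 i.1) e) s)
    (fun e => ∑ j : I, U j e) hu
    (fun s hs i e => hdiff i e s (ha.trans hs.1))
    (fun s hs i e => (hUb i s (Ioo_subset_Icc_self hs) e).1.trans (hle i e))
    (fun s hs i e => (hUb i s (Ioo_subset_Icc_self hs) e).2.trans (hle i e))
    (regIndicator I A η) M hΦ1 hΦM hΦ'M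
  -- Gaussian integration by parts of the derivative
  have hibp := pl_integral_fderiv_linGauss (ι := (zdGraph 2).edgeSet) (I := I)
    (fun (i : I) e => normWeight σ (medialPoint 1 i.1) e)
    (fun (i : I) e => deriv (fun t : ℝ => normWeight t (medialPoint 1 i.1) e) σ)
    (fun e => ∑ j : I, U j e) hu
    (fun i e => (hUb i σ hσIcc e).1.trans (hle i e))
    (fun i e => (hUb i σ hσIcc e).2.trans (hle i e))
    (regIndicator I A η) M hΦ2 hΦ'M hΦ''M
  -- assembly
  have hfun : (fun s : ℝ => regFlow I A η s) = fun s : ℝ => ∫ ξ, regIndicator I A η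
      (fun i : I => ∑' e : (zdGraph 2).edgeSet, normWeight s (medialPoint 1 i.1) e * ξ e)
      ∂(Measure.infinitePi (fun _ : (zdGraph 2).edgeSet => gaussianReal 0 1)) :=
    funext fun s => di_regFlow_eq I A η s
  rw [hfun]
  exact hmain.congr_deriv (hibp.trans (di_plackettDrift_eq I A η σ).symm)

end Summit.CriticalPhenomena.CardyFormulaZ2.Cruxes.DriftBound.Birth

end
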